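import Literature.AlgebraicGeometry.Resolution.BlowupSequencesRestrictMarked
import Literature.AlgebraicGeometry.Resolution.SubschemeRegularStalks
import Literature.AlgebraicGeometry.Resolution.StalkIdealLemmas
import Literature.AlgebraicGeometry.Resolution.NonPrincipalLocus
import HarnessLib

/-!
# Crux `PatchingRelPerfect` (stmt-ResolutionOfSingularities-16161), chain W5.2 — TargetsF5 T5-M support:
# EXTENDING a multiple blow-up from an open subscheme (centres over a set closed in the ambient scheme)

[OURS · L1 W5.2 · rung tool] res-L1-w52-stub-4 ANSWER Q4 2026-08-27T06:50:14Z spec (b) / F5-DESIGN-MEMO §5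
(res-L1-w52-plan-1 g7): the monomial-pair game `monomialSumPrincipalization_of_length_le_two` (p504028) needs its
snc boundary on the WHOLE scheme, but the mixed end of rung R4ˢ-general only has it on an open `U ⊇ cosupp K'`
(the strict transform of the member is singular far from `E'`).  This file is the EXTENSION TOOL: a multiple
blow-up `s : CentreSeq U` (tree `Literature…Resolution.CentreSeq`, BGMW Def. 3.1.4) of an open `j : U ⟶ X` of a
locally Noetherian scheme whose centres lie over a subset `Z` with `j(Z-preimage) ⊆ Z`, `Z` CLOSED IN `X`, extends
to a multiple blow-up `extend s j : CentreSeq X` — at each step the centre `C` is pushed forward to `C.map j`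
(`= C` on `U`, `= 𝒪` off the closure of `j(supp C) ⊆ Z`), the next open immersion being the lift
`Bl_C U ⟶ Bl_{C.map j} X` of the universal property (a cartesian square, GW Prop. 13.91) — with:

* `allRegular_extend` — regular centres stay regular (`V(C.map j) ≅ V(C)` stalkwise);
* `centresOver_extend` — the centres of the extension lie over `Z`;
* `isRegular_top_extend` — for `X` regular (and regular centres) the top of the extension is regular;
* `isLocallyPrincipal_comap_extend` — for an ideal sheaf `K` on `X` cosupported in `Z`:
  `K𝒪` is locally principal on the top of the extension as soon as `(K|_U)𝒪` is on the top of `s`;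
* `exists_centreSeq_of_open` — the packaged statement consumed by T5-M
  (`MonomialSumPrincipalizationLocalPair`).

Fact-free; any locally Noetherian scheme; nothing here is a statement of the manuscript under review.

## References

* U. Görtz, T. Wedhorn, *Algebraic Geometry I*, 2nd ed. (2020), Def. 13.90, Prop. 13.91 (1)–(2). [GortzWedhorn2020]
* E. Bierstone, D. Grigoriev, P. Milman, J. Włodarczyk, *Effective Hironaka resolution and its complexity*
  (2011), Def. 3.1.4, Def. 3.1.5 Remark (1). [BierstoneGrigorievMilmanWlodarczyk2011]
-/

-- `Summit.<Summit>.<Sub>.Theorems` with `Sub = Summit` (single-conjunct summit, D-0017)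
set_option linter.dupNamespace false

noncomputable section

open CategoryTheory CategoryTheory.Limits AlgebraicGeometry TopologicalSpace
open Literature.AlgebraicGeometry.Resolution

namespace Summit.ResolutionOfSingularities.ResolutionOfSingularities.Theorems

namespace CentreSeqExtend

universe u

variable {X U : Scheme.{u}}

/-! ## §1 Ideal sheaves pushed forward along an open immersion -/

/-- `j⁻¹(j_* M) = M` for a quasi-compact open immersion `j` (Mathlib's
`ker_ideal_of_isPullback_of_isOpenImmersion` on the square `V(M) ⟶ U ⟶ X`; the tree's
`Hironaka2017.S02Preliminaries.comap_map_of_isOpenImmersion`, re-proved here to keep the imports light).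
[cite: GortzWedhorn2020, Prop. 13.91 (1)] -/
theorem comap_map_of_isOpenImmersion (M : U.IdealSheafData) (j : U ⟶ X) [IsOpenImmersion j]
    [QuasiCompact j] : (M.map j).comap j = M := by
  have H : IsPullback M.subschemeι (𝟙 _) j (M.subschemeι ≫ j) := by
    simpa using (IsPullback.of_id_snd (f := M.subschemeι)).paste_horiz (IsKernelPair.id_of_mono j)
  ext W : 2
  rw [Scheme.IdealSheafData.ideal_comap_of_isOpenImmersion]
  have := Scheme.ker_ideal_of_isPullback_of_isOpenImmersion (M.subschemeι ≫ j) M.subschemeι (𝟙 _) j H W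
  rw [Scheme.IdealSheafData.ker_subschemeι] at this
  exact this.symm

/-- The support of `j_* M` lies in any closed set `Z` over which the support of `M` lies. [folklore] -/
theorem support_map_subset (M : U.IdealSheafData) (j : U ⟶ X) [IsOpenImmersion j] [QuasiCompact j]
    {Z : Set X} (hZ : IsClosed Z) (hM : (M.support : Set U) ⊆ j.base ⁻¹' Z) :
    ((M.map j).support : Set X) ⊆ Z := by
  rw [Scheme.IdealSheafData.support_map, Closeds.coe_closure]
  exact closure_minimal (Set.image_subset_iff.mpr hM) hZ

/-- The points of the support of `j_* M` are images of points of the support of `M`, when the latter lies over a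
closed set inside the image of `j`. [folklore] -/
theorem exists_eq_of_mem_support_map (M : U.IdealSheafData) (j : U ⟶ X) [IsOpenImmersion j] [QuasiCompact j]
    {Z : Set X} (hZ : IsClosed Z) (hZj : Z ⊆ Set.range j.base) (hM : (M.support : Set U) ⊆ j.base ⁻¹' Z)
    {x : X} (hx : x ∈ (M.map j).support) : ∃ u : U, j.base u = x ∧ u ∈ M.support := by
  obtain ⟨u, rfl⟩ := hZj (support_map_subset M j hZ hM hx)
  refine ⟨u, rfl, ?_⟩
  have h := (Scheme.IdealSheafData.support_comap (M.map j) j).symm ▸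
    (show u ∈ (M.map j).support.preimage j.continuous from hx)
  rwa [comap_map_of_isOpenImmersion] at h

/-- **The quotient stalks of `j_* M` at `j u` and of `M` at `u` are isomorphic** (the stalk map of an open
immersion is an isomorphism and `(j_* M)|_U = M`). [cite: GortzWedhorn2020, Prop. 13.91 (1)] -/
theorem nonempty_quotient_stalkIdeal_map_equiv (M : U.IdealSheafData) (j : U ⟶ X) [IsOpenImmersion j]
    [QuasiCompact j] (u : U) :
    Nonempty ((X.presheaf.stalk (j.base u) ⧸ stalkIdeal (M.map j) (j.base u)) ≃+*
      (U.presheaf.stalk u ⧸ stalkIdeal M u)) := by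
  let e : X.presheaf.stalk (j.base u) ≃+* U.presheaf.stalk u :=
    (asIso (j.stalkMap u)).commRingCatIsoToRingEquiv
  have h : stalkIdeal M u = (stalkIdeal (M.map j) (j.base u)).map (e : _ →+* _) := by
    conv_lhs => rw [← comap_map_of_isOpenImmersion M j]
    exact stalkIdeal_comap_eq_map_stalkMap j (M.map j) u
  exact ⟨Ideal.quotientEquiv _ _ e h⟩

/-- **`V(j_* C)` is regular when `V(C)` is**, for `C` cosupported over a closed `Z ⊆ j(U)`.
[cite: GortzWedhorn2020, Prop. 13.91 (1)] -/
theorem isRegular_subscheme_map [IsLocallyNoetherian X] [IsLocallyNoetherian U] (C : U.IdealSheafData)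
    (j : U ⟶ X) [IsOpenImmersion j] [QuasiCompact j] {Z : Set X} (hZ : IsClosed Z)
    (hZj : Z ⊆ Set.range j.base) (hC : (C.support : Set U) ⊆ j.base ⁻¹' Z)
    (hreg : Scheme.IsRegular C.subscheme) : Scheme.IsRegular (C.map j).subscheme := by
  rw [Scheme.isRegular_subscheme_iff] at hreg ⊢
  intro x hx
  obtain ⟨u, rfl, hu⟩ := exists_eq_of_mem_support_map C j hZ hZj hC hx
  obtain ⟨e⟩ := nonempty_quotient_stalkIdeal_map_equiv C j u
  haveI := hreg u hu
  exact IsRegularLocalRing.of_ringEquiv e.symm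

/-- **Local principality is decided on `U` and off the cosupport**: if `supp K ⊆ Z ⊆ j(U)` and `K|_U` is
locally principal then so is `K`. [folklore] -/
theorem isLocallyPrincipal_of_comap [IsLocallyNoetherian X] (K : X.IdealSheafData) (j : U ⟶ X)
    [IsOpenImmersion j] {Z : Set X} (hZj : Z ⊆ Set.range j.base) (hK : (K.support : Set X) ⊆ Z)
    (h : IsLocallyPrincipal (K.comap j)) : IsLocallyPrincipal K := by
  intro x
  apply isLocallyPrincipalAt_of_isPrincipal_stalkIdeal
  by_cases hx : x ∈ K.support
  · obtain ⟨u, rfl⟩ := hZj (hK hx)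
    obtain ⟨g, hg⟩ := (h u).isPrincipal_stalkIdeal
    replace hg : stalkIdeal (K.comap j) u = Ideal.span {g} := hg
    rw [stalkIdeal_comap_eq_map_stalkMap] at hg
    let e : X.presheaf.stalk (j.base u) ≃+* U.presheaf.stalk u :=
      (asIso (j.stalkMap u)).commRingCatIsoToRingEquiv
    have hcomp : e.symm.toRingHom.comp (j.stalkMap u).hom = RingHom.id _ :=
      RingHom.ext fun a => e.symm_apply_apply a
    have : stalkIdeal K (j.base u) =
        ((stalkIdeal K (j.base u)).map (j.stalkMap u).hom).map e.symm.toRingHom := by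
      rw [Ideal.map_map, hcomp, Ideal.map_id]
    refine ⟨⟨e.symm g, ?_⟩⟩
    rw [this, hg, Ideal.map_span, Set.image_singleton]
    rfl
  · rw [stalkIdeal_eq_top_of_not_mem_support hx]
    exact ⟨⟨1, by rw [Ideal.submodule_span_eq, Ideal.span_singleton_one]⟩⟩

/-! ## §2 The lifted open immersion `Bl_C U ⟶ Bl_{j_* C} X` -/

/-- The morphism `Bl_C U ⟶ Bl_{j_* C} X` over `j` given by the universal property (GW Def. 13.90; `(j_* C)|_U = C`
is pulled back to the exceptional divisor of `Bl_C U`, an effective Cartier divisor).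
[cite: GortzWedhorn2020, Def. 13.90, Prop. 13.91 (1)] -/
def liftOpen (C : U.IdealSheafData) (j : U ⟶ X) [IsOpenImmersion j] [QuasiCompact j] :
    blowup C ⟶ blowup (C.map j) :=
  (blowup.isBlowup (C.map j)).lift (blowup.π C ≫ j)
    (by
      rw [Scheme.IdealSheafData.comap_comp, comap_map_of_isOpenImmersion]
      exact (blowup.isBlowup C).isEffectiveCartier)

/-- `liftOpen C j` lies over `j`. [cite: GortzWedhorn2020, Def. 13.90] -/
@[reassoc (attr := simp)]
theorem liftOpen_π (C : U.IdealSheafData) (j : U ⟶ X) [IsOpenImmersion j] [QuasiCompact j] :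
    liftOpen C j ≫ blowup.π (C.map j) = blowup.π C ≫ j :=
  (blowup.isBlowup (C.map j)).lift_comp _ _

/-- **GW Prop. 13.91 (2): the square `(liftOpen, π_U, π_X, j)` is cartesian** — `Bl_C U = Bl_{j_* C} X ×_X U`.
[cite: GortzWedhorn2020, Prop. 13.91 (2)] -/
theorem isPullback_liftOpen (C : U.IdealSheafData) (j : U ⟶ X) [IsOpenImmersion j] [QuasiCompact j] :
    IsPullback (liftOpen C j) (blowup.π C) (blowup.π (C.map j)) j := by
  have hU : IsBlowup (blowup.π C) ((C.map j).comap j) := by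
    rw [comap_map_of_isOpenImmersion]
    exact blowup.isBlowup C
  exact (blowup.isBlowup (C.map j)).isPullback_of_isOpenImmersion j hU (liftOpen_π C j)

/-- `liftOpen C j` is an open immersion (base change of `j`). [cite: GortzWedhorn2020, Prop. 13.91 (2)] -/
theorem isOpenImmersion_liftOpen (C : U.IdealSheafData) (j : U ⟶ X) [IsOpenImmersion j] [QuasiCompact j] :
    IsOpenImmersion (liftOpen C j) :=
  MorphismProperty.of_isPullback (isPullback_liftOpen C j).flip inferInstance

/-- The preimage bookkeeping of the square: `liftOpen⁻¹(π_X⁻¹ Z) = π_U⁻¹(j⁻¹ Z)`. [folklore] -/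
theorem preimage_liftOpen (C : U.IdealSheafData) (j : U ⟶ X) [IsOpenImmersion j] [QuasiCompact j]
    (Z : Set X) :
    (liftOpen C j).base ⁻¹' (blowup.π (C.map j) ⁻¹' Z) = blowup.π C ⁻¹' (j.base ⁻¹' Z) := by
  rw [← Set.preimage_comp, ← Set.preimage_comp]
  congr 1
  funext y
  change (liftOpen C j ≫ blowup.π (C.map j)).base y = (blowup.π C ≫ j).base y
  rw [liftOpen_π]

/-- The points of `Bl_{j_* C} X` over `j(U)` come from `Bl_C U` (the square is cartesian). [folklore] -/
theorem range_liftOpen_of_mem (C : U.IdealSheafData) (j : U ⟶ X) [IsOpenImmersion j] [QuasiCompact j]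
    {Z : Set X} (hZj : Z ⊆ Set.range j.base) :
    blowup.π (C.map j) ⁻¹' Z ⊆ Set.range (liftOpen C j).base := by
  intro y hy
  obtain ⟨u, hu⟩ := hZj hy
  obtain ⟨p, hp, -⟩ := Scheme.exists_preimage_of_isPullback (isPullback_liftOpen C j) y u hu.symm
  exact ⟨p, hp⟩

/-! ## §3 The extension and its properties -/

/-- **The extension of a multiple blow-up `s` of an open `j : U ⟶ X` to `X`**: push every centre forward along
the current open immersion and continue on the lifted open immersion `Bl_C U ⟶ Bl_{j_* C} X`.
[cite: BierstoneGrigorievMilmanWlodarczyk2011, Def. 3.1.4, Def. 3.1.5 Remark (1)] -/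
def extend : {X U : Scheme.{u}} → CentreSeq U → (j : U ⟶ X) → [IsOpenImmersion j] →
    [IsLocallyNoetherian X] → CentreSeq X
  | X, _, .nil _, _, _, _ => .nil X
  | _, _, .cons C rest, j, _, _ =>
    haveI : IsProper (blowup.π (C.map j)) := (blowup.isBlowup (C.map j)).isProper
    haveI : IsLocallyNoetherian (blowup (C.map j)) :=
      LocallyOfFiniteType.isLocallyNoetherian (blowup.π (C.map j))
    haveI : IsOpenImmersion (liftOpen C j) := isOpenImmersion_liftOpen C j
    .cons (C.map j) (extend rest (liftOpen C j))

/-- Unfolding. [folklore] -/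
@[simp] theorem extend_nil (j : U ⟶ X) [IsOpenImmersion j] [IsLocallyNoetherian X] :
    extend (.nil U) j = .nil X := rfl

/-- Unfolding (with the instances the recursion uses made explicit). [folklore] -/
theorem extend_cons (C : U.IdealSheafData) (rest : CentreSeq (blowup C)) (j : U ⟶ X) [IsOpenImmersion j]
    [IsLocallyNoetherian X] :
    extend (.cons C rest) j =
      .cons (C.map j) (@extend _ _ rest (liftOpen C j) (isOpenImmersion_liftOpen C j)
        (haveI : IsProper (blowup.π (C.map j)) := (blowup.isBlowup (C.map j)).isProper
         LocallyOfFiniteType.isLocallyNoetherian (blowup.π (C.map j)))) := rfl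

/-- **The centres of the extension lie over `Z`** when those of `s` lie over `j⁻¹ Z`, `Z` closed. [folklore] -/
theorem centresOver_extend : ∀ {X U : Scheme.{u}} (s : CentreSeq U) (j : U ⟶ X) [IsOpenImmersion j]
    [IsLocallyNoetherian X] {Z : Set X}, IsClosed Z → s.CentresOver (j.base ⁻¹' Z) →
    (extend s j).CentresOver Z
  | X, _, .nil _, j, _, _, Z, _, _ => by rw [extend_nil]; trivial
  | X, U, .cons C rest, j, _, _, Z, hZ, h => by
    obtain ⟨hC, hrest⟩ := h
    rw [extend_cons, CentreSeq.centresOver_cons]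
    haveI := CentreSeq.isLocallyNoetherian_blowup (C.map j)
    haveI := isOpenImmersion_liftOpen C j
    refine ⟨support_map_subset C j hZ hC, ?_⟩
    refine centresOver_extend rest (liftOpen C j) (hZ.preimage (blowup.π (C.map j)).continuous) ?_
    rwa [preimage_liftOpen]

/-- **Regular centres stay regular** (over a closed `Z ⊆ j(U)`). [cite: GortzWedhorn2020, Prop. 13.91 (1)] -/
theorem allRegular_extend : ∀ {X U : Scheme.{u}} (s : CentreSeq U) (j : U ⟶ X) [IsOpenImmersion j]
    [IsLocallyNoetherian X] {Z : Set X}, IsClosed Z → Z ⊆ Set.range j.base →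
    s.CentresOver (j.base ⁻¹' Z) → s.AllRegular → (extend s j).AllRegular
  | X, _, .nil _, j, _, _, Z, _, _, _, _ => by rw [extend_nil]; trivial
  | X, U, .cons C rest, j, _, _, Z, hZ, hZj, h, hreg => by
    obtain ⟨hC, hrest⟩ := h
    obtain ⟨hCreg, hrestreg⟩ := hreg
    rw [extend_cons, CentreSeq.allRegular_cons]
    haveI := CentreSeq.isLocallyNoetherian_blowup (C.map j)
    haveI := isOpenImmersion_liftOpen C j
    haveI : IsLocallyNoetherian U := isLocallyNoetherian_of_isOpenImmersion j
    refine ⟨isRegular_subscheme_map C j hZ hZj hC hCreg, ?_⟩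
    exact allRegular_extend rest (liftOpen C j) (hZ.preimage (blowup.π (C.map j)).continuous)
      (range_liftOpen_of_mem C j hZj) (by rwa [preimage_liftOpen]) hrestreg

/-- **The top of a multiple blow-up with regular centres of a regular locally Noetherian scheme is regular**
(Liu Thm. 8.1.19, iterated). [folklore] -/
theorem isRegular_top_of_allRegular : ∀ {X : Scheme.{u}} (s : CentreSeq X) [IsLocallyNoetherian X],
    Scheme.IsRegular X → s.AllRegular → Scheme.IsRegular s.top
  | X, .nil _, _, hX, _ => hX
  | X, .cons C rest, _, hX, hreg => by
    obtain ⟨hC, hrest⟩ := hreg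
    haveI := CentreSeq.isLocallyNoetherian_blowup C
    rw [CentreSeq.top_cons]
    exact isRegular_top_of_allRegular rest
      ((blowup.isBlowup C).isRegular_of_isRegular_subscheme hX hC) hrest

/-- **Local principality transfers**: for `K` on `X` cosupported in a closed `Z ⊆ j(U)`, if `(K|_U)𝒪` is locally
principal on the top of `s` then `K𝒪` is locally principal on the top of the extension. [folklore] -/
theorem isLocallyPrincipal_comap_extend : ∀ {X U : Scheme.{u}} (s : CentreSeq U) (j : U ⟶ X)
    [IsOpenImmersion j] [IsLocallyNoetherian X] {Z : Set X}, IsClosed Z → Z ⊆ Set.range j.base →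
    ∀ (K : X.IdealSheafData), (K.support : Set X) ⊆ Z →
    IsLocallyPrincipal ((K.comap j).comap s.comp) → IsLocallyPrincipal (K.comap (extend s j).comp)
  | X, U, .nil _, j, _, _, Z, _, hZj, K, hK, h => by
    change @IsLocallyPrincipal X (K.comap (𝟙 X))
    change @IsLocallyPrincipal U ((K.comap j).comap (𝟙 U)) at h
    rw [Scheme.IdealSheafData.comap_id] at h ⊢
    exact isLocallyPrincipal_of_comap K j hZj hK h
  | X, U, .cons C rest, j, _, _, Z, hZ, hZj, K, hK, h => by
    haveI := CentreSeq.isLocallyNoetherian_blowup (C.map j)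
    haveI := isOpenImmersion_liftOpen C j
    change @IsLocallyPrincipal (extend rest (liftOpen C j)).top
      (K.comap ((extend rest (liftOpen C j)).comp ≫ blowup.π (C.map j)))
    change @IsLocallyPrincipal rest.top ((K.comap j).comap (rest.comp ≫ blowup.π C)) at h
    rw [Scheme.IdealSheafData.comap_comp] at h ⊢
    refine isLocallyPrincipal_comap_extend rest (liftOpen C j)
      (hZ.preimage (blowup.π (C.map j)).continuous) (range_liftOpen_of_mem C j hZj)
      (K.comap (blowup.π (C.map j))) ?_ ?_
    · rw [Scheme.IdealSheafData.support_comap]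
      exact Set.preimage_mono hK
    · have e1 : ((K.comap (blowup.π (C.map j))).comap (liftOpen C j)).comap rest.comp =
          K.comap (rest.comp ≫ blowup.π C ≫ j) := by
        rw [← Scheme.IdealSheafData.comap_comp, ← Scheme.IdealSheafData.comap_comp, Category.assoc,
          liftOpen_π]
      have e2 : ((K.comap j).comap (blowup.π C)).comap rest.comp =
          K.comap (rest.comp ≫ blowup.π C ≫ j) := by
        rw [← Scheme.IdealSheafData.comap_comp, ← Scheme.IdealSheafData.comap_comp, Category.assoc]
      rw [e1, ← e2]
      exact h

/-! ## §4 The packaged statement -/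

/-- **EXTENSION OF A MULTIPLE BLOW-UP FROM AN OPEN** (res-L1-w52-stub-4's spec, F5 T5-M): let `X` be a regular
locally Noetherian scheme, `j : U ⟶ X` an open immersion, `Z ⊆ j(U)` closed in `X`, and `s` a multiple blow-up of
`U` with regular centres over `j⁻¹ Z`.  Then there is a multiple blow-up of `X` with regular centres over `Z`,
regular top, and such that every ideal sheaf `K` of `X` cosupported in `Z` with `(K|_U)𝒪` locally principal on
the top of `s` has `K𝒪` locally principal on its top. [cite: GortzWedhorn2020, Prop. 13.91 (1)–(2)]
[cite: BierstoneGrigorievMilmanWlodarczyk2011, Def. 3.1.5 Remark (1)] -/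
theorem exists_centreSeq_of_open [IsLocallyNoetherian X] (hX : Scheme.IsRegular X) (j : U ⟶ X)
    [IsOpenImmersion j] {Z : Set X} (hZ : IsClosed Z) (hZj : Z ⊆ Set.range j.base) (s : CentreSeq U)
    (hreg : s.AllRegular) (hover : s.CentresOver (j.base ⁻¹' Z)) :
    ∃ t : CentreSeq X, t.AllRegular ∧ t.CentresOver Z ∧ Scheme.IsRegular t.top ∧
      ∀ K : X.IdealSheafData, (K.support : Set X) ⊆ Z →
        IsLocallyPrincipal ((K.comap j).comap s.comp) → IsLocallyPrincipal (K.comap t.comp) := by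
  have hreg' := allRegular_extend s j hZ hZj hover hreg
  exact ⟨extend s j, hreg', centresOver_extend s j hZ hover, isRegular_top_of_allRegular _ hX hreg',
    fun K hK h => isLocallyPrincipal_comap_extend s j hZ hZj K hK h⟩

end CentreSeqExtend

end Summit.ResolutionOfSingularities.ResolutionOfSingularities.Theorems

end
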